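import Summits.AnomalousDissipation.AnomalousDissipation.Theorems.SawtoothPulseCascadeK1LocalisedCascadePieceAffine
import Summits.AnomalousDissipation.AnomalousDissipation.Theorems.SawtoothPulseCascadeK1LocalisedCascadePhaseCut
import Summits.AnomalousDissipation.AnomalousDissipation.Theorems.SawtoothPulseCascadeK1LocalisedCascadeItinCons

/-!
# K1loc, line `Spectral` — S-D (first good piece): THE LINE REFINEMENT (route (i) of memo v8 §8, abstract form)

Helper file of the prover lane on the crux `K1LocalisedCascade` (stmt-AnomalousDissipation-19491), route
`SawtoothPulseCascade`, registered line `Cruxes.K1LocalisedCascade.Spectral` (one open stub `stub_highModeConcentration`).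
The chord `s ↦ Y + s e₀` is refined phase by phase (`n − 1, n − 2, …, 0`) into GOOD PIECES: along a piece of level `ℓ` the V-input
`X_{j′}(s)` and the H-input `W_{j′}(s)` of every phase `n − ℓ ≤ j′ < n` stay in one `ζ₂`-flat component (ranks `pV j′`, `pH j′`).  This file is
the INDUCTION, with the cascade abstracted into two families `X W : ℕ → ℝ → ℝ` and ONE analytic input `hAff` (= `…PieceAffine.piece_affine`:
on a good piece of level `ℓ` the inputs of phase `n − ℓ − 1` are affine with slopes `(itinJac γ L)₀₀`, `(itinJac γ L)₁₀ − γσ_p(itinJac γ L)₀₀`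
up to `EV`, `EH`).  The invariant at level `ℓ` (a finite family of pieces indexed by a type `ι`):
pieces `[u_i, v_i] ⊆ [0, 1]`, pairwise disjoint, `Σ|I_i| ≤ 1`, GOOD, the POTENTIAL bound
`Σ_i ((γ²−3)^{n−ℓ} |(itinJac γ L_i)₀₀|)⁻¹ ≤ B_ℓ`, and COVER (an uncovered `s ∈ [0,1]` has some input within `ζ₁ + E` of a corner).

* `lineRefine_zero`, `lineRefine_step` (one phase = `…PhaseCut.phase_cut` on every piece; `B_{ℓ+1} ≥ 4B_ℓ + 2N_j(γ+2+2/γ)/(γ²−3)^{n−ℓ}`),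
  `lineRefine` — the induction `∀ ℓ ≤ n`.

WHAT THIS IS NOT: no cascade objects (instantiated in the assembly file), no exponential sum. [cite: ElgindiLissMattingly2025, §1.2.2, §3.1]
[problem: turb]
-/

-- `Summit.<Summit>.<Problem>`: single-conjunct summit, the duplicate namespace segment is deliberate.
set_option linter.dupNamespace false

noncomputable section

namespace Summit.AnomalousDissipation.AnomalousDissipation.Theorems.SawtoothPulseCascade.K1Start

open Set Matrix Function
open Literature.Analysis.FluidPDE.SawtoothCascade

/-! ## §2 The induction -/

section Refine

variable {γ : ℝ} {n : ℕ} (N : ℕ → ℕ) (ζ₁ ζ₂ : ℕ → ℝ) {EV EH : ℝ} (X W : ℕ → ℝ → ℝ) (B : ℕ → ℝ)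

/-- **Level `0`**: the single piece `[0, 1]` (no phase consumed; potential `((γ²−3)^n)⁻¹ ≤ B₀`). [folklore] -/
theorem lineRefine_zero (hB0 : ((γ ^ 2 - 3) ^ n)⁻¹ ≤ B 0) :
    ∃ (ι : Type) (S : Finset ι) (u v : ι → ℝ) (pV pH : ι → ℕ → ℤ),
      (∀ i ∈ S, u i ≤ v i ∧ Icc (u i) (v i) ⊆ Icc (0 : ℝ) 1) ∧
      (∀ i ∈ S, ∀ i' ∈ S, i ≠ i' → Disjoint (Icc (u i) (v i)) (Icc (u i') (v i'))) ∧
      (∑ i ∈ S, (v i - u i) ≤ 1) ∧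
      (∀ i ∈ S, ∀ s ∈ Icc (u i) (v i), ∀ j', n - 0 ≤ j' → j' < n →
        X j' s ∈ Icc ((((pV i j' : ℤ) : ℝ) / 2 - 1 / 4) / N j' + ζ₂ j') ((((pV i j' : ℤ) : ℝ) / 2 + 1 / 4) / N j' - ζ₂ j') ∧
        W j' s ∈ Icc ((((pH i j' : ℤ) : ℝ) / 2 - 1 / 4) / N j' + ζ₂ j') ((((pH i j' : ℤ) : ℝ) / 2 + 1 / 4) / N j' - ζ₂ j')) ∧
      (∑ i ∈ S, ((γ ^ 2 - 3) ^ (n - 0) * |itinJac γ ((List.range 0).map fun k =>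
            (-(1 - 2 * ((pH i (n - 0 + k) % 2 : ℤ) : ℝ)), -(1 - 2 * ((pV i (n - 0 + k) % 2 : ℤ) : ℝ)))) 0 0|)⁻¹ ≤ B 0) ∧
      (∀ s ∈ Icc (0 : ℝ) 1, (∃ i ∈ S, s ∈ Icc (u i) (v i)) ∨
        ∃ j', n - 0 ≤ j' ∧ j' < n ∧ ∃ m : ℤ,
          |X j' s - ((m : ℝ) / 2 + 1 / 4) / N j'| < ζ₁ j' + EV ∨ |W j' s - ((m : ℝ) / 2 + 1 / 4) / N j'| < ζ₁ j' + EH) := by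
  refine ⟨Unit, {()}, fun _ => 0, fun _ => 1, fun _ _ => 0, fun _ _ => 0, ?_, ?_, ?_, ?_, ?_, ?_⟩
  · intro i _; exact ⟨zero_le_one, subset_rfl⟩
  · intro i _ i' _ h; exact absurd (Subsingleton.elim i i') h
  · simp
  · intro i _ s _ j' h1 h2; omega
  · simpa [itinJac] using hB0
  · intro s hs; exact Or.inl ⟨(), Finset.mem_singleton_self _, hs⟩

/-- **One phase of the refinement** (`ℓ → ℓ + 1`, phase `j = n − ℓ − 1`): every piece of level `ℓ` is cut by `phase_cut` (V-cut then
H-cut, slopes and errors from `hAff`, `|λ_V| ≥ (γ²−3)^ℓ`, `(γ − 2/γ)|λ_V| ≤ |λ_H| ≤ (γ + 2/γ)|λ_V|` from `slopes_piece`); the children are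
good pieces of level `ℓ + 1`, their lengths add up, the potential obeys `Q_{ℓ+1} ≤ 4Q_ℓ + 2N_j(γ+2+2/γ)/(γ²−3)^{n−ℓ} ≤ B_{ℓ+1}`
(`abs_itinJac_cons_entry_ge` and the counts of `phase_cut`), and the uncovered parameters are near corners.
[cite: ElgindiLissMattingly2025, §1.2.2, §3.1] -/
theorem lineRefine_step (hγ : 0 < γ) (h8 : 8 ≤ γ ^ 2) (hN : ∀ j, 0 < N j) (hζ₁ : ∀ j, 0 < ζ₁ j)
    (hζV : ∀ j, ζ₂ j + EV ≤ ζ₁ j) (hζH : ∀ j, ζ₂ j + EH ≤ ζ₁ j) {ℓ : ℕ} (hℓ : ℓ < n)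
    (hB : 4 * B ℓ + 2 * N (n - ℓ - 1) * (γ + 2 + 2 / γ) / (γ ^ 2 - 3) ^ (n - ℓ) ≤ B (ℓ + 1))
    (hAff : ∀ (u v : ℝ) (pV pH : ℕ → ℤ), u ≤ v → Icc u v ⊆ Icc (0 : ℝ) 1 →
      (∀ s ∈ Icc u v, ∀ j', n - ℓ ≤ j' → j' < n →
        X j' s ∈ Icc ((((pV j' : ℤ) : ℝ) / 2 - 1 / 4) / N j' + ζ₂ j') ((((pV j' : ℤ) : ℝ) / 2 + 1 / 4) / N j' - ζ₂ j') ∧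
        W j' s ∈ Icc ((((pH j' : ℤ) : ℝ) / 2 - 1 / 4) / N j' + ζ₂ j') ((((pH j' : ℤ) : ℝ) / 2 + 1 / 4) / N j' - ζ₂ j')) →
      (∀ s ∈ Icc u v, ∀ s' ∈ Icc u v,
        |X (n - ℓ - 1) s' - X (n - ℓ - 1) s - itinJac γ ((List.range ℓ).map fun k =>
            (-(1 - 2 * ((pH (n - ℓ + k) % 2 : ℤ) : ℝ)), -(1 - 2 * ((pV (n - ℓ + k) % 2 : ℤ) : ℝ)))) 0 0 * (s' - s)| ≤ EV) ∧
      (∀ (p : ℤ) (a b : ℝ), Icc a b ⊆ Icc u v →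
        (∀ s ∈ Icc a b, X (n - ℓ - 1) s ∈ Icc ((((p : ℤ) : ℝ) / 2 - 1 / 4) / N (n - ℓ - 1) + ζ₂ (n - ℓ - 1)) ((((p : ℤ) : ℝ) / 2 + 1 / 4) / N (n - ℓ - 1) - ζ₂ (n - ℓ - 1))) →
        ∀ s ∈ Icc a b, ∀ s' ∈ Icc a b,
          |W (n - ℓ - 1) s' - W (n - ℓ - 1) s -
            (itinJac γ ((List.range ℓ).map fun k =>
            (-(1 - 2 * ((pH (n - ℓ + k) % 2 : ℤ) : ℝ)), -(1 - 2 * ((pV (n - ℓ + k) % 2 : ℤ) : ℝ)))) 1 0 - γ * (1 - 2 * ((p % 2 : ℤ) : ℝ)) * itinJac γ ((List.range ℓ).map fun k =>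
            (-(1 - 2 * ((pH (n - ℓ + k) % 2 : ℤ) : ℝ)), -(1 - 2 * ((pV (n - ℓ + k) % 2 : ℤ) : ℝ)))) 0 0) * (s' - s)| ≤ EH))
    (hInv : ∃ (ι : Type) (S : Finset ι) (u v : ι → ℝ) (pV pH : ι → ℕ → ℤ),
      (∀ i ∈ S, u i ≤ v i ∧ Icc (u i) (v i) ⊆ Icc (0 : ℝ) 1) ∧
      (∀ i ∈ S, ∀ i' ∈ S, i ≠ i' → Disjoint (Icc (u i) (v i)) (Icc (u i') (v i'))) ∧
      (∑ i ∈ S, (v i - u i) ≤ 1) ∧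
      (∀ i ∈ S, ∀ s ∈ Icc (u i) (v i), ∀ j', n - ℓ ≤ j' → j' < n →
        X j' s ∈ Icc ((((pV i j' : ℤ) : ℝ) / 2 - 1 / 4) / N j' + ζ₂ j') ((((pV i j' : ℤ) : ℝ) / 2 + 1 / 4) / N j' - ζ₂ j') ∧
        W j' s ∈ Icc ((((pH i j' : ℤ) : ℝ) / 2 - 1 / 4) / N j' + ζ₂ j') ((((pH i j' : ℤ) : ℝ) / 2 + 1 / 4) / N j' - ζ₂ j')) ∧
      (∑ i ∈ S, ((γ ^ 2 - 3) ^ (n - ℓ) * |itinJac γ ((List.range ℓ).map fun k =>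
            (-(1 - 2 * ((pH i (n - ℓ + k) % 2 : ℤ) : ℝ)), -(1 - 2 * ((pV i (n - ℓ + k) % 2 : ℤ) : ℝ)))) 0 0|)⁻¹ ≤ B ℓ) ∧
      (∀ s ∈ Icc (0 : ℝ) 1, (∃ i ∈ S, s ∈ Icc (u i) (v i)) ∨
        ∃ j', n - ℓ ≤ j' ∧ j' < n ∧ ∃ m : ℤ,
          |X j' s - ((m : ℝ) / 2 + 1 / 4) / N j'| < ζ₁ j' + EV ∨ |W j' s - ((m : ℝ) / 2 + 1 / 4) / N j'| < ζ₁ j' + EH)) :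
    ∃ (ι : Type) (S : Finset ι) (u v : ι → ℝ) (pV pH : ι → ℕ → ℤ),
      (∀ i ∈ S, u i ≤ v i ∧ Icc (u i) (v i) ⊆ Icc (0 : ℝ) 1) ∧
      (∀ i ∈ S, ∀ i' ∈ S, i ≠ i' → Disjoint (Icc (u i) (v i)) (Icc (u i') (v i'))) ∧
      (∑ i ∈ S, (v i - u i) ≤ 1) ∧
      (∀ i ∈ S, ∀ s ∈ Icc (u i) (v i), ∀ j', n - (ℓ + 1) ≤ j' → j' < n →
        X j' s ∈ Icc ((((pV i j' : ℤ) : ℝ) / 2 - 1 / 4) / N j' + ζ₂ j') ((((pV i j' : ℤ) : ℝ) / 2 + 1 / 4) / N j' - ζ₂ j') ∧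
        W j' s ∈ Icc ((((pH i j' : ℤ) : ℝ) / 2 - 1 / 4) / N j' + ζ₂ j') ((((pH i j' : ℤ) : ℝ) / 2 + 1 / 4) / N j' - ζ₂ j')) ∧
      (∑ i ∈ S, ((γ ^ 2 - 3) ^ (n - (ℓ + 1)) * |itinJac γ ((List.range (ℓ + 1)).map fun k =>
            (-(1 - 2 * ((pH i (n - (ℓ + 1) + k) % 2 : ℤ) : ℝ)), -(1 - 2 * ((pV i (n - (ℓ + 1) + k) % 2 : ℤ) : ℝ)))) 0 0|)⁻¹ ≤ B (ℓ + 1)) ∧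
      (∀ s ∈ Icc (0 : ℝ) 1, (∃ i ∈ S, s ∈ Icc (u i) (v i)) ∨
        ∃ j', n - (ℓ + 1) ≤ j' ∧ j' < n ∧ ∃ m : ℤ,
          |X j' s - ((m : ℝ) / 2 + 1 / 4) / N j'| < ζ₁ j' + EV ∨ |W j' s - ((m : ℝ) / 2 + 1 / 4) / N j'| < ζ₁ j' + EH) := by
  classical
  obtain ⟨ι, S, u, v, pV, pH, hpiece, hdisj, hlen, hgood, hpot, hcover⟩ := hInv
  have hg3pos : 0 < γ ^ 2 - 3 := by nlinarith
  have hj1 : n - (ℓ + 1) = n - ℓ - 1 := by omega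
  have hj2 : n - ℓ = n - ℓ - 1 + 1 := by omega
  have hsl : ∀ i : ι, IsSignList ((List.range ℓ).map fun k =>
            (-(1 - 2 * ((pH i (n - ℓ + k) % 2 : ℤ) : ℝ)), -(1 - 2 * ((pV i (n - ℓ + k) % 2 : ℤ) : ℝ)))) ∧ (((List.range ℓ).map fun k =>
            (-(1 - 2 * ((pH i (n - ℓ + k) % 2 : ℤ) : ℝ)), -(1 - 2 * ((pV i (n - ℓ + k) % 2 : ℤ) : ℝ))))).length = ℓ :=
    fun i => isSignList_pieceItin (pV i) (pH i) (n - ℓ) ℓ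
  have hslope := fun i : ι => slopes_piece hγ h8 (hsl i).1
  -- the cut of every piece
  have hcut : ∀ i : ι, ∃ (pl ph : ℤ) (aV bV : ℤ → ℝ) (pl' ph' : ℤ → ℤ) (a b : ℤ → ℤ → ℝ), i ∈ S →
      ((ph : ℝ) - pl ≤ 2 * N (n - ℓ - 1) * |itinJac γ ((List.range ℓ).map fun k =>
            (-(1 - 2 * ((pH i (n - ℓ + k) % 2 : ℤ) : ℝ)), -(1 - 2 * ((pV i (n - ℓ + k) % 2 : ℤ) : ℝ)))) 0 0| * (v i - u i) + 1) ∧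
      (∀ p, (p < pl ∨ ph < p) → bV p < aV p) ∧
      (∑ p ∈ Finset.Icc pl ph, max 0 (bV p - aV p) ≤ v i - u i) ∧
      (∀ p, ((ph' p : ℝ) - pl' p ≤ 2 * N (n - ℓ - 1) *
        |itinJac γ ((List.range ℓ).map fun k =>
            (-(1 - 2 * ((pH i (n - ℓ + k) % 2 : ℤ) : ℝ)), -(1 - 2 * ((pV i (n - ℓ + k) % 2 : ℤ) : ℝ)))) 1 0 - γ * (1 - 2 * ((p % 2 : ℤ) : ℝ)) * itinJac γ ((List.range ℓ).map fun k =>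
            (-(1 - 2 * ((pH i (n - ℓ + k) % 2 : ℤ) : ℝ)), -(1 - 2 * ((pV i (n - ℓ + k) % 2 : ℤ) : ℝ)))) 0 0| * max 0 (bV p - aV p) + 1)) ∧
      (∑ p ∈ Finset.Icc pl ph, ((ph' p : ℝ) - pl' p + 1) ≤
        2 * N (n - ℓ - 1) * ((γ + 2 / γ) * |itinJac γ ((List.range ℓ).map fun k =>
            (-(1 - 2 * ((pH i (n - ℓ + k) % 2 : ℤ) : ℝ)), -(1 - 2 * ((pV i (n - ℓ + k) % 2 : ℤ) : ℝ)))) 0 0|) * (v i - u i) + 2 * (2 * N (n - ℓ - 1) * |itinJac γ ((List.range ℓ).map fun k =>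
            (-(1 - 2 * ((pH i (n - ℓ + k) % 2 : ℤ) : ℝ)), -(1 - 2 * ((pV i (n - ℓ + k) % 2 : ℤ) : ℝ)))) 0 0| * (v i - u i) + 2)) ∧
      (∀ p p', (p' < pl' p ∨ ph' p < p') → b p p' < a p p') ∧
      (∀ p p', Icc (a p p') (b p p') ⊆ Icc (aV p) (bV p) ∧ Icc (aV p) (bV p) ⊆ Icc (u i) (v i)) ∧
      (∀ p p' q q', (p, p') ≠ (q, q') → Disjoint (Icc (a p p') (b p p')) (Icc (a q q') (b q q'))) ∧
      (∀ p p', ∀ s ∈ Icc (a p p') (b p p'),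
        X (n - ℓ - 1) s ∈ Icc ((((p : ℤ) : ℝ) / 2 - 1 / 4) / N (n - ℓ - 1) + ζ₂ (n - ℓ - 1)) ((((p : ℤ) : ℝ) / 2 + 1 / 4) / N (n - ℓ - 1) - ζ₂ (n - ℓ - 1)) ∧
        W (n - ℓ - 1) s ∈ Icc ((((p' : ℤ) : ℝ) / 2 - 1 / 4) / N (n - ℓ - 1) + ζ₂ (n - ℓ - 1)) ((((p' : ℤ) : ℝ) / 2 + 1 / 4) / N (n - ℓ - 1) - ζ₂ (n - ℓ - 1))) ∧
      (∀ s ∈ Icc (u i) (v i), (∃ p p', pl ≤ p ∧ p ≤ ph ∧ pl' p ≤ p' ∧ p' ≤ ph' p ∧ s ∈ Icc (a p p') (b p p')) ∨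
        (∃ m : ℤ, |X (n - ℓ - 1) s - ((m : ℝ) / 2 + 1 / 4) / N (n - ℓ - 1)| < ζ₁ (n - ℓ - 1) + EV) ∨
        (∃ m : ℤ, |W (n - ℓ - 1) s - ((m : ℝ) / 2 + 1 / 4) / N (n - ℓ - 1)| < ζ₁ (n - ℓ - 1) + EH)) := by
    intro i
    by_cases hi : i ∈ S
    · obtain ⟨hcV, hcH⟩ := hAff (u i) (v i) (pV i) (pH i) (hpiece i hi).1 (hpiece i hi).2 (hgood i hi)
      obtain ⟨pl, ph, aV, bV, pl', ph', a, b, h⟩ := phase_cut (hN (n - ℓ - 1)) (hζ₁ (n - ℓ - 1)) (hζV (n - ℓ - 1))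
        (hζH (n - ℓ - 1)) (hpiece i hi).1 (hslope i).2.1
        (fun p : ℤ => itinJac γ ((List.range ℓ).map fun k =>
            (-(1 - 2 * ((pH i (n - ℓ + k) % 2 : ℤ) : ℝ)), -(1 - 2 * ((pV i (n - ℓ + k) % 2 : ℤ) : ℝ)))) 1 0 - γ * (1 - 2 * ((p % 2 : ℤ) : ℝ)) * itinJac γ ((List.range ℓ).map fun k =>
            (-(1 - 2 * ((pH i (n - ℓ + k) % 2 : ℤ) : ℝ)), -(1 - 2 * ((pV i (n - ℓ + k) % 2 : ℤ) : ℝ)))) 0 0)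
        (hslope i).2.2.1 (hslope i).2.2.2.2 hcV hcH
      exact ⟨pl, ph, aV, bV, pl', ph', a, b, fun _ => h⟩
    · exact ⟨0, 0, fun _ => 0, fun _ => 0, fun _ => 0, fun _ => 0, fun _ _ => 0, fun _ _ => 0, fun h => absurd h hi⟩
  choose pl ph aV bV pl' ph' a b hcut using hcut
  -- the children
  set T : Finset (Σ _ : ι, Σ _ : ℤ, ℤ) :=
    S.sigma fun i => (Finset.Icc (pl i) (ph i)).sigma fun p => Finset.Icc (pl' i p) (ph' i p) with hTdef
  set S' : Finset (Σ _ : ι, Σ _ : ℤ, ℤ) := T.filter fun c => a c.1 c.2.1 c.2.2 ≤ b c.1 c.2.1 c.2.2 with hS'def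
  have hT : ∀ c : (Σ _ : ι, Σ _ : ℤ, ℤ), c ∈ T ↔
      c.1 ∈ S ∧ (pl c.1 ≤ c.2.1 ∧ c.2.1 ≤ ph c.1) ∧ (pl' c.1 c.2.1 ≤ c.2.2 ∧ c.2.2 ≤ ph' c.1 c.2.1) := by
    intro c; simp only [hTdef, Finset.mem_sigma, Finset.mem_Icc]
  have hS' : ∀ c : (Σ _ : ι, Σ _ : ℤ, ℤ), c ∈ S' ↔
      (c.1 ∈ S ∧ (pl c.1 ≤ c.2.1 ∧ c.2.1 ≤ ph c.1) ∧ (pl' c.1 c.2.1 ≤ c.2.2 ∧ c.2.2 ≤ ph' c.1 c.2.1)) ∧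
        a c.1 c.2.1 c.2.2 ≤ b c.1 c.2.1 c.2.2 := by
    intro c; rw [hS'def, Finset.mem_filter, hT]
  have hnest : ∀ c : (Σ _ : ι, Σ _ : ℤ, ℤ), c.1 ∈ S → Icc (a c.1 c.2.1 c.2.2) (b c.1 c.2.1 c.2.2) ⊆ Icc (u c.1) (v c.1) :=
    fun c hc => ((hcut c.1 hc).2.2.2.2.2.2.1 c.2.1 c.2.2).1.trans ((hcut c.1 hc).2.2.2.2.2.2.1 c.2.1 c.2.2).2
  refine ⟨(Σ _ : ι, Σ _ : ℤ, ℤ), S', fun c => a c.1 c.2.1 c.2.2, fun c => b c.1 c.2.1 c.2.2,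
    fun c j' => if j' = n - ℓ - 1 then c.2.1 else pV c.1 j', fun c j' => if j' = n - ℓ - 1 then c.2.2 else pH c.1 j',
    ?_, ?_, ?_, ?_, ?_, ?_⟩
  · -- pieces
    intro c hc
    obtain ⟨⟨hi, -, -⟩, hab⟩ := (hS' c).1 hc
    exact ⟨hab, (hnest c hi).trans (hpiece c.1 hi).2⟩
  · -- pairwise disjoint
    rintro ⟨i, p, p'⟩ hc ⟨i', q, q'⟩ hc' hne
    obtain ⟨⟨hi, -, -⟩, -⟩ := (hS' _).1 hc
    obtain ⟨⟨hi', -, -⟩, -⟩ := (hS' _).1 hc'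
    dsimp only at hi hi' ⊢
    by_cases hii : i = i'
    · subst hii
      refine (hcut i hi).2.2.2.2.2.2.2.1 p p' q q' fun h => hne ?_
      simp only [Prod.mk.injEq] at h
      rw [h.1, h.2]
    · exact Set.disjoint_of_subset (hnest ⟨i, p, p'⟩ hi) (hnest ⟨i', q, q'⟩ hi') (hdisj i hi i' hi' hii)
  · -- lengths
    have h1 : ∑ c ∈ S', (b c.1 c.2.1 c.2.2 - a c.1 c.2.1 c.2.2) ≤
        ∑ c ∈ T, max 0 (b c.1 c.2.1 c.2.2 - a c.1 c.2.1 c.2.2) :=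
      (Finset.sum_le_sum fun c _ => le_max_right _ _).trans
        (Finset.sum_le_sum_of_subset_of_nonneg (Finset.filter_subset _ _) fun c _ _ => le_max_left _ _)
    have h2 : ∑ c ∈ T, max 0 (b c.1 c.2.1 c.2.2 - a c.1 c.2.1 c.2.2) =
        ∑ i ∈ S, ∑ p ∈ Finset.Icc (pl i) (ph i), ∑ p' ∈ Finset.Icc (pl' i p) (ph' i p), max 0 (b i p p' - a i p p') := by
      rw [hTdef, Finset.sum_sigma]
      exact Finset.sum_congr rfl fun i _ => Finset.sum_sigma _ _ _
    have h3 : ∀ i ∈ S, ∀ p, ∑ p' ∈ Finset.Icc (pl' i p) (ph' i p), max 0 (b i p p' - a i p p') ≤ max 0 (bV i p - aV i p) := by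
      intro i hi p
      obtain ⟨-, -, -, -, -, -, hnst, hdisjC, -, -⟩ := hcut i hi
      rcases le_or_gt (aV i p) (bV i p) with hab | hab
      · rw [max_eq_right (sub_nonneg.mpr hab)]
        exact sum_length_children_le _ hab (fun p' _ => (hnst p p').1)
          (fun p' _ q' _ hne => hdisjC p p' p q' fun h => hne (Prod.ext_iff.mp h).2)
      · have h0 : ∀ p', max 0 (b i p p' - a i p p') = 0 := by
          intro p'
          refine max_eq_left (sub_nonpos.mpr (le_of_lt (not_le.mp fun hle => ?_)))
          have hmem := (hnst p p').1 (left_mem_Icc.mpr hle)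
          exact absurd (hmem.1.trans hmem.2) (not_le.mpr hab)
        simp [h0]
    calc ∑ c ∈ S', (b c.1 c.2.1 c.2.2 - a c.1 c.2.1 c.2.2)
        ≤ ∑ i ∈ S, ∑ p ∈ Finset.Icc (pl i) (ph i), ∑ p' ∈ Finset.Icc (pl' i p) (ph' i p),
            max 0 (b i p p' - a i p p') := h1.trans_eq h2
      _ ≤ ∑ i ∈ S, ∑ p ∈ Finset.Icc (pl i) (ph i), max 0 (bV i p - aV i p) :=
          Finset.sum_le_sum fun i hi => Finset.sum_le_sum fun p _ => h3 i hi p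
      _ ≤ ∑ i ∈ S, (v i - u i) := Finset.sum_le_sum fun i hi => (hcut i hi).2.2.1
      _ ≤ 1 := hlen
  · -- good pieces of level ℓ + 1
    rintro ⟨i, p, p'⟩ hc s hs j' hj'1 hj'2
    obtain ⟨⟨hi, -, -⟩, -⟩ := (hS' _).1 hc
    dsimp only at hs ⊢
    by_cases hjj : j' = n - ℓ - 1
    · rw [if_pos hjj, if_pos hjj, hjj]
      exact (hcut i hi).2.2.2.2.2.2.2.2.1 p p' s hs
    · rw [if_neg hjj, if_neg hjj]
      exact hgood i hi s (hnest ⟨i, p, p'⟩ hi hs) j' (by omega) hj'2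
  · -- the potential
    beta_reduce
    have hterm : ∀ c ∈ S', ((γ ^ 2 - 3) ^ (n - (ℓ + 1)) * |itinJac γ ((List.range (ℓ + 1)).map fun k =>
            (-(1 - 2 * (((if n - (ℓ + 1) + k = n - ℓ - 1 then c.2.2 else pH c.1 (n - (ℓ + 1) + k)) % 2 : ℤ) : ℝ)),
             -(1 - 2 * (((if n - (ℓ + 1) + k = n - ℓ - 1 then c.2.1 else pV c.1 (n - (ℓ + 1) + k)) % 2 : ℤ) : ℝ)))) 0 0|)⁻¹ ≤
        ((γ ^ 2 - 3) ^ (n - ℓ) * |itinJac γ ((List.range ℓ).map fun k =>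
            (-(1 - 2 * ((pH c.1 (n - ℓ + k) % 2 : ℤ) : ℝ)), -(1 - 2 * ((pV c.1 (n - ℓ + k) % 2 : ℤ) : ℝ)))) 0 0|)⁻¹ := by
      intro c hc
      obtain ⟨⟨hi, -, -⟩, -⟩ := (hS' c).1 hc
      rw [pieceItin_cons hℓ (pV c.1) (pH c.1) c.2.1 c.2.2]
      have hge := abs_itinJac_cons_entry_ge hγ h8 (hsl c.1).1 (r := -(1 - 2 * ((c.2.2 % 2 : ℤ) : ℝ)))
        (s := -(1 - 2 * ((c.2.1 % 2 : ℤ) : ℝ)))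
        (by rcases rankSign_eq_or c.2.2 with h | h <;> rw [h] <;> norm_num)
        (by rcases rankSign_eq_or c.2.1 with h | h <;> rw [h] <;> norm_num)
      refine inv_anti₀ (mul_pos (pow_pos hg3pos _) (abs_pos.mpr (hslope c.1).2.1)) ?_
      calc (γ ^ 2 - 3) ^ (n - ℓ) * |itinJac γ ((List.range ℓ).map fun k =>
            (-(1 - 2 * ((pH c.1 (n - ℓ + k) % 2 : ℤ) : ℝ)), -(1 - 2 * ((pV c.1 (n - ℓ + k) % 2 : ℤ) : ℝ)))) 0 0|
          = (γ ^ 2 - 3) ^ (n - (ℓ + 1)) * ((γ ^ 2 - 3) * |itinJac γ ((List.range ℓ).map fun k =>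
            (-(1 - 2 * ((pH c.1 (n - ℓ + k) % 2 : ℤ) : ℝ)), -(1 - 2 * ((pV c.1 (n - ℓ + k) % 2 : ℤ) : ℝ)))) 0 0|) := by
            rw [hj2, hj1, pow_succ, mul_assoc]
        _ ≤ _ := mul_le_mul_of_nonneg_left hge (pow_nonneg hg3pos.le _)
    have hcount : ∀ i ∈ S, ∑ p ∈ Finset.Icc (pl i) (ph i), ((Finset.Icc (pl' i p) (ph' i p)).card : ℝ) ≤
        2 * N (n - ℓ - 1) * ((γ + 2 / γ) * |itinJac γ ((List.range ℓ).map fun k =>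
            (-(1 - 2 * ((pH i (n - ℓ + k) % 2 : ℤ) : ℝ)), -(1 - 2 * ((pV i (n - ℓ + k) % 2 : ℤ) : ℝ)))) 0 0|) * (v i - u i) +
          2 * (2 * N (n - ℓ - 1) * |itinJac γ ((List.range ℓ).map fun k =>
            (-(1 - 2 * ((pH i (n - ℓ + k) % 2 : ℤ) : ℝ)), -(1 - 2 * ((pV i (n - ℓ + k) % 2 : ℤ) : ℝ)))) 0 0| * (v i - u i) + 2) := by
      intro i hi
      obtain ⟨hcountV, -, hlenV, hcountH, -, -, -, -, -, -⟩ := hcut i hi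
      have hvu : 0 ≤ v i - u i := sub_nonneg.mpr (hpiece i hi).1
      have h1 : ∀ p, ((Finset.Icc (pl' i p) (ph' i p)).card : ℝ) ≤
          2 * N (n - ℓ - 1) * ((γ + 2 / γ) * |itinJac γ ((List.range ℓ).map fun k =>
            (-(1 - 2 * ((pH i (n - ℓ + k) % 2 : ℤ) : ℝ)), -(1 - 2 * ((pV i (n - ℓ + k) % 2 : ℤ) : ℝ)))) 0 0|) * max 0 (bV i p - aV i p) + 2 := by
        intro p
        refine (card_Icc_le _ _).trans (max_le (by positivity) ?_)
        have h4 := hcountH p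
        have h5 := mul_le_mul_of_nonneg_right
          (mul_le_mul_of_nonneg_left ((hslope i).2.2.2.2 p) (by positivity : (0 : ℝ) ≤ 2 * N (n - ℓ - 1)))
          (le_max_left 0 (bV i p - aV i p))
        linarith
      have h2 : ((Finset.Icc (pl i) (ph i)).card : ℝ) ≤ 2 * N (n - ℓ - 1) * |itinJac γ ((List.range ℓ).map fun k =>
            (-(1 - 2 * ((pH i (n - ℓ + k) % 2 : ℤ) : ℝ)), -(1 - 2 * ((pV i (n - ℓ + k) % 2 : ℤ) : ℝ)))) 0 0| * (v i - u i) + 2 :=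
        (card_Icc_le _ _).trans (max_le (by positivity) (by linarith))
      calc ∑ p ∈ Finset.Icc (pl i) (ph i), ((Finset.Icc (pl' i p) (ph' i p)).card : ℝ)
          ≤ ∑ p ∈ Finset.Icc (pl i) (ph i),
              (2 * N (n - ℓ - 1) * ((γ + 2 / γ) * |itinJac γ ((List.range ℓ).map fun k =>
            (-(1 - 2 * ((pH i (n - ℓ + k) % 2 : ℤ) : ℝ)), -(1 - 2 * ((pV i (n - ℓ + k) % 2 : ℤ) : ℝ)))) 0 0|) * max 0 (bV i p - aV i p) + 2) :=
            Finset.sum_le_sum fun p _ => h1 p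
        _ = 2 * N (n - ℓ - 1) * ((γ + 2 / γ) * |itinJac γ ((List.range ℓ).map fun k =>
            (-(1 - 2 * ((pH i (n - ℓ + k) % 2 : ℤ) : ℝ)), -(1 - 2 * ((pV i (n - ℓ + k) % 2 : ℤ) : ℝ)))) 0 0|) * ∑ p ∈ Finset.Icc (pl i) (ph i), max 0 (bV i p - aV i p) +
              2 * (Finset.Icc (pl i) (ph i)).card := by
            rw [Finset.sum_add_distrib, ← Finset.mul_sum, Finset.sum_const, nsmul_eq_mul]; ring
        _ ≤ _ := by
            have := mul_le_mul_of_nonneg_left hlenV (by positivity : (0 : ℝ) ≤ 2 * N (n - ℓ - 1) * ((γ + 2 / γ) * |itinJac γ ((List.range ℓ).map fun k =>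
            (-(1 - 2 * ((pH i (n - ℓ + k) % 2 : ℤ) : ℝ)), -(1 - 2 * ((pV i (n - ℓ + k) % 2 : ℤ) : ℝ)))) 0 0|))
            linarith
    have hK0 : ∀ i, 0 ≤ ((γ ^ 2 - 3) ^ (n - ℓ) * |itinJac γ ((List.range ℓ).map fun k =>
            (-(1 - 2 * ((pH i (n - ℓ + k) % 2 : ℤ) : ℝ)), -(1 - 2 * ((pV i (n - ℓ + k) % 2 : ℤ) : ℝ)))) 0 0|)⁻¹ :=
      fun i => inv_nonneg.mpr (mul_nonneg (pow_nonneg hg3pos.le _) (abs_nonneg _))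
    have hcoef : 0 ≤ 2 * N (n - ℓ - 1) * (γ + 2 + 2 / γ) / (γ ^ 2 - 3) ^ (n - ℓ) :=
      div_nonneg (by positivity) (pow_nonneg hg3pos.le _)
    calc ∑ c ∈ S', ((γ ^ 2 - 3) ^ (n - (ℓ + 1)) * |itinJac γ ((List.range (ℓ + 1)).map fun k =>
            (-(1 - 2 * (((if n - (ℓ + 1) + k = n - ℓ - 1 then c.2.2 else pH c.1 (n - (ℓ + 1) + k)) % 2 : ℤ) : ℝ)),
             -(1 - 2 * (((if n - (ℓ + 1) + k = n - ℓ - 1 then c.2.1 else pV c.1 (n - (ℓ + 1) + k)) % 2 : ℤ) : ℝ)))) 0 0|)⁻¹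
        ≤ ∑ c ∈ S', ((γ ^ 2 - 3) ^ (n - ℓ) * |itinJac γ ((List.range ℓ).map fun k =>
            (-(1 - 2 * ((pH c.1 (n - ℓ + k) % 2 : ℤ) : ℝ)), -(1 - 2 * ((pV c.1 (n - ℓ + k) % 2 : ℤ) : ℝ)))) 0 0|)⁻¹ := Finset.sum_le_sum hterm
      _ ≤ ∑ c ∈ T, ((γ ^ 2 - 3) ^ (n - ℓ) * |itinJac γ ((List.range ℓ).map fun k =>
            (-(1 - 2 * ((pH c.1 (n - ℓ + k) % 2 : ℤ) : ℝ)), -(1 - 2 * ((pV c.1 (n - ℓ + k) % 2 : ℤ) : ℝ)))) 0 0|)⁻¹ :=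
          Finset.sum_le_sum_of_subset_of_nonneg (Finset.filter_subset _ _) fun c _ _ => hK0 c.1
      _ = ∑ i ∈ S, ∑ p ∈ Finset.Icc (pl i) (ph i), ∑ _p' ∈ Finset.Icc (pl' i p) (ph' i p),
            ((γ ^ 2 - 3) ^ (n - ℓ) * |itinJac γ ((List.range ℓ).map fun k =>
            (-(1 - 2 * ((pH i (n - ℓ + k) % 2 : ℤ) : ℝ)), -(1 - 2 * ((pV i (n - ℓ + k) % 2 : ℤ) : ℝ)))) 0 0|)⁻¹ := by
          rw [hTdef, Finset.sum_sigma]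
          exact Finset.sum_congr rfl fun i _ => Finset.sum_sigma _ _ _
      _ = ∑ i ∈ S, (∑ p ∈ Finset.Icc (pl i) (ph i), ((Finset.Icc (pl' i p) (ph' i p)).card : ℝ)) *
            ((γ ^ 2 - 3) ^ (n - ℓ) * |itinJac γ ((List.range ℓ).map fun k =>
            (-(1 - 2 * ((pH i (n - ℓ + k) % 2 : ℤ) : ℝ)), -(1 - 2 * ((pV i (n - ℓ + k) % 2 : ℤ) : ℝ)))) 0 0|)⁻¹ := by
          refine Finset.sum_congr rfl fun i _ => ?_
          rw [Finset.sum_mul]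
          refine Finset.sum_congr rfl fun p _ => ?_
          rw [Finset.sum_const, nsmul_eq_mul]
      _ ≤ ∑ i ∈ S, (2 * N (n - ℓ - 1) * ((γ + 2 / γ) * |itinJac γ ((List.range ℓ).map fun k =>
            (-(1 - 2 * ((pH i (n - ℓ + k) % 2 : ℤ) : ℝ)), -(1 - 2 * ((pV i (n - ℓ + k) % 2 : ℤ) : ℝ)))) 0 0|) * (v i - u i) +
            2 * (2 * N (n - ℓ - 1) * |itinJac γ ((List.range ℓ).map fun k =>
            (-(1 - 2 * ((pH i (n - ℓ + k) % 2 : ℤ) : ℝ)), -(1 - 2 * ((pV i (n - ℓ + k) % 2 : ℤ) : ℝ)))) 0 0| * (v i - u i) + 2)) * ((γ ^ 2 - 3) ^ (n - ℓ) * |itinJac γ ((List.range ℓ).map fun k =>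
            (-(1 - 2 * ((pH i (n - ℓ + k) % 2 : ℤ) : ℝ)), -(1 - 2 * ((pV i (n - ℓ + k) % 2 : ℤ) : ℝ)))) 0 0|)⁻¹ :=
          Finset.sum_le_sum fun i hi => mul_le_mul_of_nonneg_right (hcount i hi) (hK0 i)
      _ = ∑ i ∈ S, (2 * N (n - ℓ - 1) * (γ + 2 + 2 / γ) / (γ ^ 2 - 3) ^ (n - ℓ) * (v i - u i) +
            4 * ((γ ^ 2 - 3) ^ (n - ℓ) * |itinJac γ ((List.range ℓ).map fun k =>
            (-(1 - 2 * ((pH i (n - ℓ + k) % 2 : ℤ) : ℝ)), -(1 - 2 * ((pV i (n - ℓ + k) % 2 : ℤ) : ℝ)))) 0 0|)⁻¹) := by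
          refine Finset.sum_congr rfl fun i _ => ?_
          have hJ : |itinJac γ ((List.range ℓ).map fun k =>
            (-(1 - 2 * ((pH i (n - ℓ + k) % 2 : ℤ) : ℝ)), -(1 - 2 * ((pV i (n - ℓ + k) % 2 : ℤ) : ℝ)))) 0 0| ≠ 0 := (abs_pos.mpr (hslope i).2.1).ne'
          have hg : (γ ^ 2 - 3) ^ (n - ℓ) ≠ 0 := (pow_pos hg3pos _).ne'
          field_simp
          ring
      _ = 2 * N (n - ℓ - 1) * (γ + 2 + 2 / γ) / (γ ^ 2 - 3) ^ (n - ℓ) * ∑ i ∈ S, (v i - u i) +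
            4 * ∑ i ∈ S, ((γ ^ 2 - 3) ^ (n - ℓ) * |itinJac γ ((List.range ℓ).map fun k =>
            (-(1 - 2 * ((pH i (n - ℓ + k) % 2 : ℤ) : ℝ)), -(1 - 2 * ((pV i (n - ℓ + k) % 2 : ℤ) : ℝ)))) 0 0|)⁻¹ := by
          rw [Finset.sum_add_distrib, ← Finset.mul_sum, ← Finset.mul_sum]
      _ ≤ 2 * N (n - ℓ - 1) * (γ + 2 + 2 / γ) / (γ ^ 2 - 3) ^ (n - ℓ) * 1 + 4 * B ℓ := by
          have := mul_le_mul_of_nonneg_left hlen hcoef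
          linarith
      _ ≤ B (ℓ + 1) := by linarith
  · -- cover
    intro s hs
    rcases hcover s hs with ⟨i, hi, hsi⟩ | ⟨j', hj'1, hj'2, m, hm⟩
    · rcases (hcut i hi).2.2.2.2.2.2.2.2.2 s hsi with ⟨p, p', hp1, hp2, hq1, hq2, hsab⟩ | ⟨m, hm⟩ | ⟨m, hm⟩
      · exact Or.inl ⟨⟨i, p, p'⟩, (hS' _).2 ⟨⟨hi, ⟨hp1, hp2⟩, ⟨hq1, hq2⟩⟩, hsab.1.trans hsab.2⟩, hsab⟩
      · exact Or.inr ⟨n - ℓ - 1, by omega, by omega, m, Or.inl hm⟩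
      · exact Or.inr ⟨n - ℓ - 1, by omega, by omega, m, Or.inr hm⟩
    · exact Or.inr ⟨j', by omega, hj'2, m, hm⟩

/-- **The line refinement** (route (i) of memo v8 §8): for every `ℓ ≤ n` the chord carries a finite family of good pieces of level `ℓ`
with disjoint supports in `[0, 1]`, total length `≤ 1`, potential `≤ B_ℓ` and the corner-cover property, provided
`B₀ ≥ (γ²−3)^{−n}`, `B_{ℓ+1} ≥ 4B_ℓ + 2N_{n−ℓ−1}(γ+2+2/γ)/(γ²−3)^{n−ℓ}`, `ζ₂ + E_V ≤ ζ₁`, `ζ₂ + E_H ≤ ζ₁`, and the per-piece affinity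
`hAff` (`…PieceAffine.piece_affine`).  [cite: ElgindiLissMattingly2025, §1.2.2, §3.1] -/
theorem lineRefine (hγ : 0 < γ) (h8 : 8 ≤ γ ^ 2) (hN : ∀ j, 0 < N j) (hζ₁ : ∀ j, 0 < ζ₁ j)
    (hζV : ∀ j, ζ₂ j + EV ≤ ζ₁ j) (hζH : ∀ j, ζ₂ j + EH ≤ ζ₁ j) (hB0 : ((γ ^ 2 - 3) ^ n)⁻¹ ≤ B 0)
    (hB : ∀ ℓ, ℓ < n → 4 * B ℓ + 2 * N (n - ℓ - 1) * (γ + 2 + 2 / γ) / (γ ^ 2 - 3) ^ (n - ℓ) ≤ B (ℓ + 1))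
    (hAff : ∀ ℓ, ℓ < n → ∀ (u v : ℝ) (pV pH : ℕ → ℤ), u ≤ v → Icc u v ⊆ Icc (0 : ℝ) 1 →
      (∀ s ∈ Icc u v, ∀ j', n - ℓ ≤ j' → j' < n →
        X j' s ∈ Icc ((((pV j' : ℤ) : ℝ) / 2 - 1 / 4) / N j' + ζ₂ j') ((((pV j' : ℤ) : ℝ) / 2 + 1 / 4) / N j' - ζ₂ j') ∧
        W j' s ∈ Icc ((((pH j' : ℤ) : ℝ) / 2 - 1 / 4) / N j' + ζ₂ j') ((((pH j' : ℤ) : ℝ) / 2 + 1 / 4) / N j' - ζ₂ j')) →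
      (∀ s ∈ Icc u v, ∀ s' ∈ Icc u v,
        |X (n - ℓ - 1) s' - X (n - ℓ - 1) s - itinJac γ ((List.range ℓ).map fun k =>
            (-(1 - 2 * ((pH (n - ℓ + k) % 2 : ℤ) : ℝ)), -(1 - 2 * ((pV (n - ℓ + k) % 2 : ℤ) : ℝ)))) 0 0 * (s' - s)| ≤ EV) ∧
      (∀ (p : ℤ) (a b : ℝ), Icc a b ⊆ Icc u v →
        (∀ s ∈ Icc a b, X (n - ℓ - 1) s ∈ Icc ((((p : ℤ) : ℝ) / 2 - 1 / 4) / N (n - ℓ - 1) + ζ₂ (n - ℓ - 1)) ((((p : ℤ) : ℝ) / 2 + 1 / 4) / N (n - ℓ - 1) - ζ₂ (n - ℓ - 1))) →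
        ∀ s ∈ Icc a b, ∀ s' ∈ Icc a b,
          |W (n - ℓ - 1) s' - W (n - ℓ - 1) s -
            (itinJac γ ((List.range ℓ).map fun k =>
            (-(1 - 2 * ((pH (n - ℓ + k) % 2 : ℤ) : ℝ)), -(1 - 2 * ((pV (n - ℓ + k) % 2 : ℤ) : ℝ)))) 1 0 - γ * (1 - 2 * ((p % 2 : ℤ) : ℝ)) * itinJac γ ((List.range ℓ).map fun k =>
            (-(1 - 2 * ((pH (n - ℓ + k) % 2 : ℤ) : ℝ)), -(1 - 2 * ((pV (n - ℓ + k) % 2 : ℤ) : ℝ)))) 0 0) * (s' - s)| ≤ EH)) :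
    ∀ ℓ, ℓ ≤ n → ∃ (ι : Type) (S : Finset ι) (u v : ι → ℝ) (pV pH : ι → ℕ → ℤ),
      (∀ i ∈ S, u i ≤ v i ∧ Icc (u i) (v i) ⊆ Icc (0 : ℝ) 1) ∧
      (∀ i ∈ S, ∀ i' ∈ S, i ≠ i' → Disjoint (Icc (u i) (v i)) (Icc (u i') (v i'))) ∧
      (∑ i ∈ S, (v i - u i) ≤ 1) ∧
      (∀ i ∈ S, ∀ s ∈ Icc (u i) (v i), ∀ j', n - ℓ ≤ j' → j' < n →
        X j' s ∈ Icc ((((pV i j' : ℤ) : ℝ) / 2 - 1 / 4) / N j' + ζ₂ j') ((((pV i j' : ℤ) : ℝ) / 2 + 1 / 4) / N j' - ζ₂ j') ∧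
        W j' s ∈ Icc ((((pH i j' : ℤ) : ℝ) / 2 - 1 / 4) / N j' + ζ₂ j') ((((pH i j' : ℤ) : ℝ) / 2 + 1 / 4) / N j' - ζ₂ j')) ∧
      (∑ i ∈ S, ((γ ^ 2 - 3) ^ (n - ℓ) * |itinJac γ ((List.range ℓ).map fun k =>
            (-(1 - 2 * ((pH i (n - ℓ + k) % 2 : ℤ) : ℝ)), -(1 - 2 * ((pV i (n - ℓ + k) % 2 : ℤ) : ℝ)))) 0 0|)⁻¹ ≤ B ℓ) ∧
      (∀ s ∈ Icc (0 : ℝ) 1, (∃ i ∈ S, s ∈ Icc (u i) (v i)) ∨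
        ∃ j', n - ℓ ≤ j' ∧ j' < n ∧ ∃ m : ℤ,
          |X j' s - ((m : ℝ) / 2 + 1 / 4) / N j'| < ζ₁ j' + EV ∨ |W j' s - ((m : ℝ) / 2 + 1 / 4) / N j'| < ζ₁ j' + EH) := by
  intro ℓ
  induction ℓ with
  | zero => exact fun _ => lineRefine_zero N ζ₁ ζ₂ X W B hB0
  | succ ℓ ih => exact fun hℓ =>
      lineRefine_step N ζ₁ ζ₂ X W B hγ h8 hN hζ₁ hζV hζH (by omega) (hB ℓ (by omega)) (hAff ℓ (by omega)) (ih (by omega))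

end Refine

end Summit.AnomalousDissipation.AnomalousDissipation.Theorems.SawtoothPulseCascade.K1Start
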